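import Mathlib.NumberTheory.Padics.PadicNumbers
import Mathlib.Analysis.SpecialFunctions.Exp
import Mathlib.LinearAlgebra.Dimension.Finrank
import HarnessLib

/-!
# The `p`-adic Nesterenko linear independence criterion (Chantanasiri 2012; Sprang 2020, Thm 1.4), case `K = ℚ`

Topic `Literature/NumberTheory/DiophantineApproximation`. Typed, cited statement (named fact, no proof) of the
`p`-adic analogue of Nesterenko's 1985 criterion (tree, Archimedean exact-rate form PROVED:
`Literature.NumberTheory.Transcendental.nesterenko_criterion`), as printed in

* J. Sprang, *Linear independence result for `p`-adic `L`-values*, Duke Math. J. 169 (2020) 3439–3476 =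
  arXiv:1809.07714 [Sprang2020], §1 (held: `paper:arxiv-1809.07714`, p. 4):

  "**Theorem 1.4.** Let `τ₁, τ₂, τ` be positive real numbers and `σ(n)` a non-decreasing positive function
  satisfying `lim_{n→∞} σ(n) = ∞` and `lim_{n→∞} σ(n+1)/σ(n) = 1`. Let `θ = (θ₁, …, θ_s) ∈ ℂ_p^s`. Assume that for all
  sufficiently large integers `n`, there exists a linear form with coefficients in the ring of integers `𝒪_K` of the
  number field `K` in `s+1` variables `Λ_n(X) = λ_{0,n} X₀ + λ_{1,n} X₁ + ⋯ + λ_{s,n} X_s`, `λ_{i,n} ∈ 𝒪_K` satisfying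
  `H_K(Λ_n) ≤ e^{σ(n)(τ + o(1))}` and `e^{−(τ₁+o(1))σ(n)} ≤ |Λ_n(1, θ)|_p ≤ e^{−(τ₂−o(1))σ(n)}`. Then
  `dim_K(K + Kθ₁ + ⋯ + Kθ_s) ≥ τ₁/(τ + τ₁ − τ₂)`. Here, the height of the linear form `Λ_n` is defined as
  `H_K(Λ_n) := max_{0≤i≤s} |N_K(λ_{i,n})|`, with `N_K : K → ℚ` the norm map."

  ("This variant of Nesterenko's criterion is essentially based on Chantanasiri's work, but the proof for general
  number fields does not appear in the literature. We include the proof in §7"; §7: "The present criterion is proven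
  in the case `K = ℚ` by Chantanasiri [A. Chantanasiri, Ann. Math. Blaise Pascal 19 (2012) 75–105], see also
  [colmez].") It is the criterion through which [Sprang2020, Thm 1.1 / Cor. 1.2] and [Lai2024BallRivoal, Thm 1.2]
  ("We use the following formulation (see [15, Theorem 1.4])", §2) obtain their dimension bounds — tree:
  `Literature.NumberTheory.Irrationality.PAdicZetaValues.sprang2020_corollary12_rat`, `….lai2024_theorem12`.

TYPED HERE FOR `K = ℚ` ONLY (`𝒪_K = ℤ`, `N_K = id`, `H(Λ) = max_i |λ_i|`, `θ ∈ ℚ_p^s`): the tree has no `ℂ_p`-valued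
embedding of a general number field set up for this purpose — TODO(general form): `K ⊆ ℚ̄ ⊂ ℂ_p` a number field.
Rendering of the three `o(1)`'s: sequences `δ₁, δ₂, δ₃ → 0` with, for all sufficiently large `n`,
`|λ_{i,n}| ≤ e^{σ(n)(τ + δ₁(n))}` (all `i`), `e^{−(τ₁ + δ₂(n))σ(n)} ≤ |Λ_n(1,θ)|_p ≤ e^{−(τ₂ − δ₃(n))σ(n)}`;
`Λ_n(1, θ) = λ_{0,n} + Σ_{i=1}^s λ_{i,n} θ_i`; `dim_ℚ(ℚ + ℚθ₁ + ⋯ + ℚθ_s)` = `Module.finrank ℚ` of the `ℚ`-span of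
`{1} ∪ {θ_i}` in `ℚ_[p]`; `|·|_p` = the norm of `ℚ_[p]` (no renormalisation — "The main difference to Nesterenko's
criterion … is the missing renormalization of the `p`-adic norm of the linear form", §7).

Cell zeta5-irr (HONEST FRAMING): a criterion, typed as a hypothesis; nothing about `ζ(5)`.
-/

noncomputable section

open Filter
open scoped Topology

namespace Literature.NumberTheory.DiophantineApproximation

/-- **Sprang 2020, Theorem 1.4 (Chantanasiri's `p`-adic Nesterenko criterion), case `K = ℚ`** (named fact, statement
only): with `τ₁, τ₂, τ > 0`, `σ` non-decreasing positive, `σ(n) → ∞`, `σ(n+1)/σ(n) → 1`, `θ ∈ ℚ_p^s`, and integer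
linear forms `Λ_n = λ_{0,n} X₀ + ⋯ + λ_{s,n} X_s` for all large `n` with `max_i |λ_{i,n}| ≤ e^{σ(n)(τ + o(1))}` and
`e^{−(τ₁+o(1))σ(n)} ≤ |Λ_n(1, θ)|_p ≤ e^{−(τ₂−o(1))σ(n)}`, one has `dim_ℚ(ℚ + ℚθ₁ + ⋯ + ℚθ_s) ≥ τ₁/(τ + τ₁ − τ₂)`.
(TODO(general form): number field `K ⊂ ℂ_p`, `λ_{i,n} ∈ 𝒪_K`, `H_K = max |N_K(λ_{i,n})|`, `dim_K`, bound divided by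
nothing else.) [cite: Sprang2020, Thm 1.4 (§1; proof §7)] -/
def sprang2020_theorem14_rat : Prop :=
  ∀ (p : ℕ) [Fact p.Prime] (s : ℕ) (θ : Fin s → ℚ_[p]) (τ₁ τ₂ τ : ℝ) (σ : ℕ → ℝ) (lam : ℕ → Fin (s + 1) → ℤ),
    0 < τ₁ → 0 < τ₂ → 0 < τ →
    Monotone σ → (∀ n, 0 < σ n) → Tendsto σ atTop atTop →
    Tendsto (fun n => σ (n + 1) / σ n) atTop (𝓝 1) →
    (∃ δ₁ δ₂ δ₃ : ℕ → ℝ, Tendsto δ₁ atTop (𝓝 0) ∧ Tendsto δ₂ atTop (𝓝 0) ∧ Tendsto δ₃ atTop (𝓝 0) ∧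
      ∀ᶠ n in atTop,
        (∀ i, (|lam n i| : ℝ) ≤ Real.exp (σ n * (τ + δ₁ n))) ∧
        Real.exp (-(τ₁ + δ₂ n) * σ n) ≤
            ‖(lam n 0 : ℚ_[p]) + ∑ i : Fin s, (lam n i.succ : ℚ_[p]) * θ i‖ ∧
        ‖(lam n 0 : ℚ_[p]) + ∑ i : Fin s, (lam n i.succ : ℚ_[p]) * θ i‖ ≤
            Real.exp (-(τ₂ - δ₃ n) * σ n)) →
    τ₁ / (τ + τ₁ - τ₂) ≤
      (Module.finrank ℚ ↥(Submodule.span ℚ (insert (1 : ℚ_[p]) (Set.range θ))) : ℝ)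

end Literature.NumberTheory.DiophantineApproximation
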